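import Summits.Ventures.WeilGRH.UniformConductorFloorJointData
import HarnessLib

/-!
# GRH arm (rh-explicit, venture WeilGRH): the kernel check of the joint cell certificate `certEven320`

Cell `rh-explicit`, WEIL TRACK — GRH ARM (weil-grh-1).  `JointCert.checkFrame`, `checkOne` and `checkCells` of the even
pseudo-key certificate `certEven320` (`UniformConductorFloorJointData.lean`), by `decide +kernel`: integer arithmetic only
(exact rational slab tables against `(319/320)^(a k)` via `Nat.pow`, the `320` cell inequalities by the `O(J²)` zipper).
Consumed by `UniformConductorFloorJointFloors.lean`.  No definitions; no named facts; standard axioms. [folklore]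
-/

namespace Summit.Ventures.WeilGRH

namespace UniformFloor

set_option maxHeartbeats 0 in
/-- The frame of `certEven320` checks (shape, `φ` bounds, shifts, exact slab masses, exact constant, `e^{2t} ≤ 8`). [folklore] -/
theorem certEven320_checkFrame : certEven320.checkFrame = true := by
  decide +kernel

set_option maxHeartbeats 0 in
/-- The window of `certEven320` contains `[-1, 1]` (`e · (319/320)^320 ≤ 1`). [folklore] -/
theorem certEven320_checkOne : certEven320.checkOne = true := by
  decide +kernel

set_option maxHeartbeats 0 in
/-- All `320` cell inequalities of `certEven320` (the zipper `JointCert.checkCells`). [folklore] -/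
theorem certEven320_checkCells : certEven320.checkCells = true := by
  decide +kernel

end UniformFloor

end Summit.Ventures.WeilGRH
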